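import Literature.Computability.AlgebraicComplexity.KaltofenFactorFromRoots
import Literature.Computability.AlgebraicComplexity.CommutativeExtensionSimulation
import Literature.Computability.AlgebraicComplexity.DetInVP
import HarnessLib

/-!
# Kaltofen's factor theorem over an arbitrary field: étale descent of the all-roots route (engine)

`KaltofenFactorFromRoots.complexity_le_of_rootData` bounds the circuit complexity of a factor
`P̂ = a₀ · P` of `G ∈ F[x_β, y]` (`P` monic in `y`) from ROOT DATA: a set of `δ = deg_y P` simple
roots of `P(0, Y)` in `F` avoiding `Q(0, Y)`, where `G = P · Q`.  Over a field that is not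
algebraically closed such roots need not exist.  This file removes that hypothesis: it proves the
same kind of bound (`complexity_le_of_coprimeData`) from the COPRIMALITY datum
`gcd(P(0, Y), Q(0, Y) · ∂_Y P(0, Y)) = 1` alone, over an arbitrary field `F`.

## The argument (étale descent)

Let `P₀ = P(0, Y) ∈ F[Y]`, `A = F[T]/(P₀)` (an étale `F`-algebra of dimension `δ`, basis
`1, θ, …, θ^{δ-1}`), and let `v ∈ F[Y]` be a Bézout cofactor, `u P₀ + v · (Q ∂_Y P)(0, Y) = 1`.
* Run `N` steps of the slow Newton iteration `w ↦ w - v(θ) · (P Q)(x, w)` over `A[x_β]` from `θ`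
  (`complexity_newton_iterate_ring_le`: cost `≤ N (L(G) + 2)` as an `A`-circuit); call the result
  `Z`.
* Let `M` be the matrix of multiplication by `Z` on `A[x_β] = ⊕_j F[x_β] θ^j` (entries
  `lmap (coord k) (Z θ^j)`, computed by the Hrubeš–Yehudayoff simulation
  `CommExtSim.complexity_lmap_le`) and `χ = charpoly M ∈ F[x_β][Y]`.
* Over the algebraic closure `K`, `P₀` has `δ` distinct roots `c_i` (it is separable by the
  coprimality datum), the `F`-algebra maps `κ_i : A → K, θ ↦ c_i` carry `Z` to the field Newton
  roots `z_i = newtonRoot (P Q) c_i N` of `KaltofenFactorFromRoots` (`map_newton_iterate`), and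
  Vandermonde conjugation gives `χ = ∏_i (Y - z_i)` in `K[x_β][Y]`
  (`charpoly_map_eq_prod_of_roots`).  By `coeff_sub_prod_newtonRoot_vanish` (over `K`) the
  coefficients of `P - χ` vanish to order `N + 1`; this descends to `F` (`vanish_of_vanish_map`).
* Hence `P̂ = Σ_{k ≤ N} HomogeneousComponent_k (a₀ · χ(x, y))`
  (`eq_sum_homogeneousComponent_of_coeff_vanish`), and `χ(x, y)` is the determinant of a
  `δ × δ` matrix of cheap entries, costed by `complexity_detPoly_le` (Berkowitz, `8(δ+1)⁷`).

Main result: `KaltofenFactor.complexity_le_of_coprimeData`.  The assembly into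
`KaltofenFactorBoundWith F κ` for every field of characteristic zero is appended to
`KaltofenFactorClosureProofs.lean`.

## References
* [DuttaSaxenaSinhababu2018] P. Dutta, N. Saxena, A. Sinhababu, *Discovering the roots: uniform
  closure results for algebraic classes under factoring*, STOC 2018 / arXiv:1710.03214, Thm. 4,
  Cor. 5, §1.3.
* [Burgisser2024Completeness] P. Bürgisser, *Completeness classes in algebraic complexity theory*
  (2024 survey), Thm. 3.2 (Kaltofen's theorem).
* [HrubesYehudayoff2011] P. Hrubeš, A. Yehudayoff, *Arithmetic complexity in ring extensions*,
  Theory of Computing 7 (2011), Thm 4.2.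
* [Kaltofen1989] E. Kaltofen, *Factorization of polynomials given by straight-line programs*,
  in: Randomness and Computation, JAI Press 1989, Thm. 5.
-/

noncomputable section

namespace Literature.Computability.AlgebraicComplexity

open MvPolynomial Finset CommExtSim

namespace KaltofenFactor

/-! ### Slow Newton iteration over a commutative coefficient ring, with an explicit inverse -/

section RingNewton

variable {A : Type*} [CommRing A] {β : Type*}

/-- `optionEquivLeft` turns substitution for `y` into evaluation (over any commutative ring).
[folklore] -/
private theorem eval_optionEquivLeft_ring (H : MvPolynomial (Option β) A) (z : MvPolynomial β A) :
    Polynomial.eval z (optionEquivLeft A β H) = aeval (fun o : Option β => o.elim z X) H := by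
  have key : ((Polynomial.aeval z : Polynomial (MvPolynomial β A) →ₐ[MvPolynomial β A]
      MvPolynomial β A).restrictScalars A).comp
        (optionEquivLeft A β : MvPolynomial (Option β) A →ₐ[A] Polynomial (MvPolynomial β A)) =
      aeval (fun o : Option β => o.elim z X) := by
    refine MvPolynomial.algHom_ext fun o => ?_
    rcases o with _ | b
    · simp
    · simp
  have := AlgHom.congr_fun key H
  simpa [Polynomial.coe_aeval_eq_eval] using this

variable [Fintype β]

/-- **Cost of the slow Newton iteration over a commutative coefficient ring** (twin of
`RootLifting.complexity_newton_iterate_le`, with the inverse `ξ⁻¹` replaced by any ring element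
`ξinv`): `r` substitutions into the fixed polynomial `y - ξinv · G(x, y)` cost `≤ r (L(G) + 2)`.
[cite: DuttaSaxenaSinhababu2018, §1.3 (slow Newton iteration)] -/
theorem complexity_newton_iterate_ring_le (G : MvPolynomial (Option β) A) (ξinv c : A) (r : ℕ) :
    complexity ((fun z => z - C ξinv * (optionEquivLeft A β G).eval z)^[r] (C c)) ≤
      r * (complexity G + 2) := by
  classical
  have hstep : ∀ z : MvPolynomial β A,
      aeval (fun o : Option β => o.elim z X) (X none + C (-ξinv) * G) =
        z - C ξinv * (optionEquivLeft A β G).eval z := by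
    intro z
    rw [eval_optionEquivLeft_ring]
    simp only [map_add, map_mul, aeval_X, aeval_C, algebraMap_eq, Option.elim_none, map_neg]
    ring
  have hG'c : complexity (X none + C (-ξinv) * G) ≤ complexity G + 2 := by
    calc complexity (X none + C (-ξinv) * G) ≤ complexity (X none : MvPolynomial (Option β) A) +
          complexity (C (-ξinv) * G) + 1 := complexity_add_le_holds _ _
      _ ≤ 0 + (complexity (C (-ξinv) : MvPolynomial (Option β) A) + complexity G + 1) + 1 := by
          gcongr
          · exact (complexity_X_holds _).le
          · exact complexity_mul_le_holds _ _
      _ = complexity G + 2 := by rw [complexity_C_holds]; ring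
  induction r with
  | zero => rw [Function.iterate_zero_apply, complexity_C_holds]; exact Nat.zero_le _
  | succ r ih =>
    have hsumX : ∑ b : β, complexity (X b : MvPolynomial β A) = 0 :=
      Finset.sum_eq_zero fun b _ => complexity_X_holds (k := A) b
    rw [Function.iterate_succ_apply', ← hstep]
    calc complexity (aeval (fun o : Option β =>
            o.elim ((fun z => z - C ξinv * (optionEquivLeft A β G).eval z)^[r] (C c)) X)
            (X none + C (-ξinv) * G))
        ≤ complexity (X none + C (-ξinv) * G) + ∑ o : Option β, complexity ((fun o : Option β =>
            o.elim ((fun z => z - C ξinv * (optionEquivLeft A β G).eval z)^[r] (C c)) X) o) :=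
          complexity_aeval_le _ _
      _ = complexity (X none + C (-ξinv) * G) +
            complexity ((fun z => z - C ξinv * (optionEquivLeft A β G).eval z)^[r] (C c)) := by
          rw [Fintype.sum_option]
          simp only [Option.elim_none, Option.elim_some, hsumX, add_zero]
      _ ≤ (complexity G + 2) + r * (complexity G + 2) := add_le_add hG'c ih
      _ = (r + 1) * (complexity G + 2) := by ring

end RingNewton

/-! ### Change of scalars -/

section BaseChange

variable {L K : Type*} [CommRing L] [CommRing K] {β : Type*}

/-- Change of scalars commutes with `optionEquivLeft`. [folklore] -/
private theorem optionEquivLeft_map (ι : L →+* K) (H : MvPolynomial (Option β) L) :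
    optionEquivLeft K β (MvPolynomial.map ι H) =
      Polynomial.map (MvPolynomial.map ι) (optionEquivLeft L β H) := by
  have key : ((optionEquivLeft K β : MvPolynomial (Option β) K ≃ₐ[K]
      Polynomial (MvPolynomial β K)) : MvPolynomial (Option β) K →+* Polynomial (MvPolynomial β K)).comp
        (MvPolynomial.map ι) =
      (Polynomial.mapRingHom (MvPolynomial.map ι)).comp
        ((optionEquivLeft L β : MvPolynomial (Option β) L ≃ₐ[L] Polynomial (MvPolynomial β L)) :
          MvPolynomial (Option β) L →+* Polynomial (MvPolynomial β L)) := by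
    refine MvPolynomial.ringHom_ext (fun r => ?_) (fun o => ?_)
    · simp [optionEquivLeft_C]
    · rcases o with _ | b
      · simp [optionEquivLeft_X_none]
      · simp [optionEquivLeft_X_some]
  exact RingHom.congr_fun key H

/-- `constantCoeff` commutes with change of scalars. [folklore] -/
private theorem constantCoeff_comp_map (ι : L →+* K) :
    (constantCoeff : MvPolynomial β K →+* K).comp (MvPolynomial.map ι) =
      ι.comp (constantCoeff : MvPolynomial β L →+* L) := by
  refine MvPolynomial.ringHom_ext (fun r => ?_) (fun b => ?_)
  · simp
  · simp

/-- Evaluating a mapped univariate polynomial at a mapped point. [folklore] -/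
private theorem map_polynomial_eval (ι : L →+* K) (φ : Polynomial (MvPolynomial β L))
    (w : MvPolynomial β L) :
    MvPolynomial.map ι (φ.eval w) =
      (φ.map (MvPolynomial.map ι)).eval (MvPolynomial.map ι w) := by
  rw [Polynomial.eval_map, Polynomial.eval, Polynomial.hom_eval₂, RingHom.comp_id]

/-- Vanishing order descends along an injective change of scalars. [folklore] -/
private theorem vanish_of_vanish_map {ι : L →+* K} (hι : Function.Injective ι) {j : ℕ}
    {p : MvPolynomial β L}
    (h : ∀ k < j, homogeneousComponent k (MvPolynomial.map ι p) = 0) :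
    ∀ k < j, homogeneousComponent k p = 0 := by
  intro k hk
  apply map_injective ι hι
  rw [map_zero, ← h k hk]
  ext m
  classical
  simp only [coeff_map, coeff_homogeneousComponent]
  split_ifs <;> simp

end BaseChange

/-! ### Functoriality of the Newton iteration under a ring map to a field -/

section Functoriality

variable {A K : Type*} [CommRing A] [Field K] {β : Type*}

/-- **The Newton iteration commutes with every ring map into a field** that sends the explicit
inverse `ξinv` to the inverse of the derivative at the image point: the image of the ring
iterate from `θ` is the (field) `newtonRoot` from `κ θ`. [folklore] -/
private theorem map_newton_iterate (κ : A →+* K) (φ : Polynomial (MvPolynomial β A)) (ξinv θ : A)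
    (hξ : κ ξinv * coeff 0 ((Polynomial.derivative (φ.map (MvPolynomial.map κ))).eval
      (C (κ θ))) = 1) (N : ℕ) :
    MvPolynomial.map κ ((fun w => w - C ξinv * φ.eval w)^[N] (C θ)) =
      newtonRoot (φ.map (MvPolynomial.map κ)) (κ θ) N := by
  have hinv : κ ξinv = (coeff 0 ((Polynomial.derivative (φ.map (MvPolynomial.map κ))).eval
      (C (κ θ))))⁻¹ := eq_inv_of_mul_eq_one_left hξ
  induction N with
  | zero =>
    rw [Function.iterate_zero_apply, newtonRoot_def, Function.iterate_zero_apply, map_C]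
  | succ N ih =>
    rw [Function.iterate_succ_apply', newtonRoot_def, Function.iterate_succ_apply',
      ← newtonRoot_def, map_sub, map_mul, map_C, ih, hinv, map_polynomial_eval, ih]

end Functoriality

/-! ### The characteristic polynomial of multiplication by `Z` is the product over the roots -/

section Charpoly

variable {F K : Type*} [Field F] [Field K] {β : Type*}

/-- **Vandermonde conjugation.** Let `P₀ ∈ F[T]` be monic of degree `δ`, `A = F[T]/(P₀)` with its
power basis `1, θ, …, θ^{δ-1}`, `Z ∈ A[x]`, and `M ∈ F[x]^{δ×δ}` the matrix of multiplication by
`Z` (`Z · θ^j = Σ_k M_{jk} θ^k`, coordinates read off by `lmap`). If `c_1, …, c_δ` are DISTINCT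
roots of `P₀` in a field `K ⊇ F`, then over `K[x]` the characteristic polynomial of `M` is
`∏_i (Y - κ_i(Z))`, where `κ_i : A → K` sends `θ ↦ c_i` (applied coefficientwise): indeed
`M · W = W · diag(κ_i Z)` for the (transposed, invertible) Vandermonde matrix `W_{ki} = c_i^k`.
[folklore] -/
private theorem charpoly_map_eq_prod_of_roots (ιK : F →+* K) {P₀ : Polynomial F} (hP₀ : P₀.Monic)
    (ZA : MvPolynomial β (AdjoinRoot P₀)) (c : Fin P₀.natDegree → K)
    (hc : Function.Injective c) (hroot : ∀ i, P₀.eval₂ ιK (c i) = 0) :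
    (Matrix.charpoly (Matrix.of fun j k : Fin P₀.natDegree =>
        lmap ((AdjoinRoot.powerBasis' hP₀).basis.coord k)
          (ZA * C (AdjoinRoot.root P₀ ^ (j : ℕ))))).map (MvPolynomial.map ιK) =
      ∏ i, (Polynomial.X - Polynomial.C
        (MvPolynomial.map (AdjoinRoot.lift ιK (c i) (hroot i)) ZA)) := by
  classical
  set pb := AdjoinRoot.powerBasis' hP₀ with hpb
  set M : Matrix (Fin P₀.natDegree) (Fin P₀.natDegree) (MvPolynomial β F) :=
    Matrix.of fun j k : Fin P₀.natDegree =>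
      lmap (pb.basis.coord k) (ZA * C (AdjoinRoot.root P₀ ^ (j : ℕ))) with hM
  set z : Fin P₀.natDegree → MvPolynomial β K :=
    fun i => MvPolynomial.map (AdjoinRoot.lift ιK (c i) (hroot i)) ZA with hz
  -- coordinates along the power basis
  have hcoord : ∀ j : Fin P₀.natDegree, ZA * C (AdjoinRoot.root P₀ ^ (j : ℕ)) =
      ∑ k : Fin P₀.natDegree, C (AdjoinRoot.root P₀ ^ (k : ℕ)) *
        MvPolynomial.map (algebraMap F (AdjoinRoot P₀)) (M j k) := by
    intro j
    have h := eq_sum_C_mul_map_coord pb.basis (ZA * C (AdjoinRoot.root P₀ ^ (j : ℕ)))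
    have hgen : pb.gen = AdjoinRoot.root P₀ := rfl
    refine h.trans (Finset.sum_congr rfl fun k _ => ?_)
    rw [pb.basis_eq_pow k, hgen, hM, Matrix.of_apply]
  -- apply the root maps
  have hκof : ∀ i, (AdjoinRoot.lift ιK (c i) (hroot i)).comp
      (algebraMap F (AdjoinRoot P₀)) = ιK := fun i => by
    rw [AdjoinRoot.algebraMap_eq]
    exact AdjoinRoot.lift_comp_of _
  have hrel : ∀ i j : Fin P₀.natDegree, z i * C (c i ^ (j : ℕ)) =
      ∑ k : Fin P₀.natDegree, MvPolynomial.map ιK (M j k) * C (c i ^ (k : ℕ)) := by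
    intro i j
    have h := congrArg (MvPolynomial.map (AdjoinRoot.lift ιK (c i) (hroot i))) (hcoord j)
    rw [map_mul, map_C, map_pow, AdjoinRoot.lift_root, map_sum] at h
    rw [hz]
    refine h.trans (Finset.sum_congr rfl fun k _ => ?_)
    rw [map_mul, map_C, map_pow, AdjoinRoot.lift_root, MvPolynomial.map_map, hκof, mul_comm]
  -- the Vandermonde conjugation
  set W : Matrix (Fin P₀.natDegree) (Fin P₀.natDegree) (MvPolynomial β K) :=
    Matrix.of fun k i => C (c i ^ (k : ℕ)) with hW
  have hMW : M.map (MvPolynomial.map ιK) * W = W * Matrix.diagonal z := by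
    refine Matrix.ext fun j i => ?_
    rw [Matrix.mul_diagonal, Matrix.mul_apply, hW, Matrix.of_apply, mul_comm, hrel i j]
    refine Finset.sum_congr rfl fun k _ => ?_
    rw [Matrix.map_apply, Matrix.of_apply]
  have hWdet : IsUnit W.det := by
    have hWeq : W = Matrix.transpose ((Matrix.vandermonde c).map (C : K →+* MvPolynomial β K)) := by
      refine Matrix.ext fun k i => ?_
      rw [hW, Matrix.of_apply, Matrix.transpose_apply, Matrix.map_apply, Matrix.vandermonde_apply]
    rw [hWeq, Matrix.det_transpose, ← RingHom.mapMatrix_apply, ← RingHom.map_det]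
    exact ((isUnit_iff_ne_zero.2 (Matrix.det_vandermonde_ne_zero_iff.2 hc)).map _)
  obtain ⟨Wu, hWu⟩ := (Matrix.isUnit_iff_isUnit_det W).2 hWdet
  have hMK : M.map (MvPolynomial.map ιK) = W * Matrix.diagonal z * W⁻¹ := by
    rw [← hMW, Matrix.mul_nonsing_inv_cancel_right _ _ hWdet]
  rw [← Matrix.charpoly_map, hMK, ← hWu, Matrix.charpoly_units_conj, Matrix.charpoly_diagonal]

end Charpoly

/-! ### The engine over an arbitrary field: factor = characteristic polynomial of the generic
Newton root, truncated -/

section Engine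

variable {F : Type*} [Field F] {β : Type*}

/-- `optionEquivLeft.symm` on constants is `rename some`. [folklore] -/
private theorem optionEquivLeft_symm_polyC (u : MvPolynomial β F) :
    (optionEquivLeft F β).symm (Polynomial.C u) = rename some u := by
  simp only [optionEquivLeft_symm_apply, Polynomial.aevalTower_C]

/-- Cost of an entry of the characteristic matrix read in `F[x, y]`. [folklore] -/
private theorem complexity_symm_charmatrix_le {n : ℕ}
    (Mm : Matrix (Fin n) (Fin n) (MvPolynomial β F)) (j k : Fin n) {B : ℕ}
    (h : complexity (Mm j k) ≤ B) :
    complexity ((optionEquivLeft F β).symm (Matrix.charmatrix Mm j k)) ≤ B + 2 := by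
  classical
  rw [Matrix.charmatrix_apply, map_sub, Matrix.diagonal_apply, optionEquivLeft_symm_polyC,
    sub_eq_add_neg]
  have ha : complexity ((optionEquivLeft F β).symm
      (if j = k then (Polynomial.X : Polynomial (MvPolynomial β F)) else 0)) = 0 := by
    split_ifs
    · rw [optionEquivLeft_symm_X, complexity_X_holds]
    · rw [map_zero, ← C_0, complexity_C_holds]
  calc complexity ((optionEquivLeft F β).symm
        (if j = k then (Polynomial.X : Polynomial (MvPolynomial β F)) else 0) +
          -rename some (Mm j k))
      ≤ complexity ((optionEquivLeft F β).symm
          (if j = k then (Polynomial.X : Polynomial (MvPolynomial β F)) else 0)) +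
          complexity (-rename some (Mm j k) : MvPolynomial (Option β) F) + 1 :=
        complexity_add_le_holds _ _
    _ ≤ 0 + (complexity (rename some (Mm j k) : MvPolynomial (Option β) F) + 1) + 1 := by
        rw [ha]
        gcongr
        exact complexity_neg_le _
    _ ≤ 0 + (B + 1) + 1 := by
        gcongr
        exact (complexity_rename_le_holds' _ _).trans h
    _ = B + 2 := by ring

variable [Fintype β]

/-- **Kaltofen's factor bound from COPRIMALITY data, over an arbitrary field (engine).** Let
`G, P̂ ∈ F[x_β, y]` with `optionEquivLeft G = P · Q`, `optionEquivLeft P̂ = a₀ · P`, `P` monic of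
`y`-degree `δ`, and suppose the specialisations at `x = 0` satisfy
`gcd(P(0, Y), Q(0, Y) · ∂_Y P(0, Y)) = 1` (Bézout form). Then for every `N ≥ deg P̂`,
`L(P̂) ≤ (N+2)² · (8(δ+1)⁷ + δ² · ((5δ³+6δ²+2δ)(N(L(G)+2)+1) + 3δ + 2) + 1) + (N+1)`.
Proof (étale descent of the all-roots route): with `A = F[T]/(P(0,T))` and `θ` the class of `T`,
run `N` slow-Newton steps for `P · Q` over `A` from `θ` (the derivative at `θ` is a unit by
Bézout); the factor `P` is congruent modulo `⟨x⟩^{N+1}` to the characteristic polynomial of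
multiplication by the iterate `Z` (checked over the algebraic closure, where it is
`∏_c (Y - z_c)` by Vandermonde conjugation and the Newton iteration commutes with `θ ↦ c`;
`KaltofenFactorFromRoots.coeff_sub_prod_newtonRoot_vanish`); so `P̂` is the truncation at degree `N`
of `a₀ · charpoly` (`eq_sum_homogeneousComponent_of_coeff_vanish`), whose cost is controlled by the
Hrubeš–Yehudayoff simulation of `A`-arithmetic (`CommExtSim.complexity_lmap_le`) and Berkowitz'
determinant circuits (`complexity_detPoly_le`).
[cite: DuttaSaxenaSinhababu2018, Thm. 4 and Cor. 5; Burgisser2024Completeness, Thm. 3.2; HrubesYehudayoff2011, Thm 4.2] -/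
theorem complexity_le_of_coprimeData (G Ph : MvPolynomial (Option β) F) (a₀ : F)
    (P Q : Polynomial (MvPolynomial β F)) (hP : P.Monic)
    (hG : optionEquivLeft F β G = P * Q)
    (hPh : optionEquivLeft F β Ph = Polynomial.C (C a₀) * P)
    (hcop : IsCoprime (P.map (constantCoeff : MvPolynomial β F →+* F))
      ((Q * Polynomial.derivative P).map (constantCoeff : MvPolynomial β F →+* F)))
    {N : ℕ} (hN : Ph.totalDegree ≤ N) :
    complexity Ph ≤ (N + 2) ^ 2 * (8 * (P.natDegree + 1) ^ 7 + P.natDegree ^ 2 *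
        ((5 * P.natDegree ^ 3 + 6 * P.natDegree ^ 2 + 2 * P.natDegree) *
          (N * (complexity G + 2) + 1) + 3 * P.natDegree + 2) + 1) + (N + 1) := by
  classical
  -- s0: the specialised data and Bézout
  set P₀ : Polynomial F := P.map (constantCoeff : MvPolynomial β F →+* F) with hP₀
  set T₀ : Polynomial F :=
    (Q * Polynomial.derivative P).map (constantCoeff : MvPolynomial β F →+* F) with hT₀
  have hP₀m : P₀.Monic := hP.map _
  have hδ : P₀.natDegree = P.natDegree := hP.natDegree_map _
  obtain ⟨u, v, huv⟩ := hcop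
  -- s1: the étale algebra `A = F[T]/(P₀)` and the Newton iterate over it
  set ιA : F →+* AdjoinRoot P₀ := algebraMap F (AdjoinRoot P₀) with hιA
  set θ : AdjoinRoot P₀ := AdjoinRoot.root P₀ with hθ
  set ξinv : AdjoinRoot P₀ := AdjoinRoot.mk P₀ v with hξinv
  set GA : MvPolynomial (Option β) (AdjoinRoot P₀) := MvPolynomial.map ιA G with hGA
  set ZA : MvPolynomial β (AdjoinRoot P₀) :=
    (fun w => w - C ξinv * (optionEquivLeft (AdjoinRoot P₀) β GA).eval w)^[N] (C θ) with hZA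
  have hEGA : optionEquivLeft (AdjoinRoot P₀) β GA = (P * Q).map (MvPolynomial.map ιA) := by
    rw [hGA, optionEquivLeft_map, hG]
  set Mm : Matrix (Fin P₀.natDegree) (Fin P₀.natDegree) (MvPolynomial β F) :=
    Matrix.of fun j k : Fin P₀.natDegree =>
      lmap ((AdjoinRoot.powerBasis' hP₀m).basis.coord k)
        (ZA * C (AdjoinRoot.root P₀ ^ (j : ℕ))) with hMm
  set Mch : Polynomial (MvPolynomial β F) := Mm.charpoly with hMch
  -- s2: the algebraic closure, the roots of `P₀`
  set ιK : F →+* AlgebraicClosure F := algebraMap F (AlgebraicClosure F) with hιK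
  have hιKinj : Function.Injective ιK := (algebraMap F (AlgebraicClosure F)).injective
  have hP₀Km : (P₀.map ιK).Monic := hP₀m.map _
  have hsepF : P₀.Separable := by
    rw [Polynomial.separable_def]
    have h1 : IsCoprime P₀ T₀ := ⟨u, v, huv⟩
    rw [hT₀, Polynomial.map_mul, ← Polynomial.derivative_map] at h1
    exact h1.of_mul_right_right
  have hsepK : (P₀.map ιK).Separable := hsepF.map
  set S : Finset (AlgebraicClosure F) := (P₀.map ιK).roots.toFinset with hS
  have hP₀K0 : P₀.map ιK ≠ 0 := hP₀Km.ne_zero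
  have hScard : S.card = P.natDegree := by
    rw [hS, Multiset.toFinset_card_of_nodup (Polynomial.nodup_roots hsepK),
      ← (IsAlgClosed.splits (P₀.map ιK)).natDegree_eq_card_roots, hP₀m.natDegree_map, hδ]
  have hmemS : ∀ c ∈ S, (P₀.map ιK).IsRoot c := fun c hc => by
    rw [hS, Multiset.mem_toFinset, Polynomial.mem_roots hP₀K0] at hc
    exact hc
  -- s3: the all-roots theorem over the algebraic closure
  set PK : Polynomial (MvPolynomial β (AlgebraicClosure F)) := P.map (MvPolynomial.map ιK)
    with hPK
  set QK : Polynomial (MvPolynomial β (AlgebraicClosure F)) := Q.map (MvPolynomial.map ιK)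
    with hQK
  have hPKm : PK.Monic := hP.map _
  have hPKdeg : PK.natDegree = P.natDegree := hP.natDegree_map _
  have hcc := constantCoeff_comp_map (β := β) ιK
  have hPKcc : PK.map constantCoeff = P₀.map ιK := by
    rw [hPK, Polynomial.map_map, hcc, ← Polynomial.map_map]
  have hQKcc : QK.map constantCoeff = (Q.map (constantCoeff : MvPolynomial β F →+* F)).map ιK := by
    rw [hQK, Polynomial.map_map, hcc, ← Polynomial.map_map]
  have hPK'cc : (Polynomial.derivative PK).map constantCoeff =
      (Polynomial.derivative P₀).map ιK := by
    rw [← Polynomial.derivative_map, hPKcc, Polynomial.derivative_map]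
  have hT₀split : T₀.map ιK = (Q.map (constantCoeff : MvPolynomial β F →+* F)).map ιK *
      (Polynomial.derivative P₀).map ιK := by
    rw [hT₀, Polynomial.map_mul, Polynomial.map_mul, Polynomial.derivative_map]
  have hbezK : ∀ c : AlgebraicClosure F, (u.map ιK).eval c * (P₀.map ιK).eval c +
      (v.map ιK).eval c * (T₀.map ιK).eval c = 1 := by
    intro c
    have h1 := congrArg (fun q : Polynomial F => (q.map ιK).eval c) huv
    simpa only [Polynomial.map_add, Polynomial.map_mul, Polynomial.map_one, Polynomial.eval_add,
      Polynomial.eval_mul, Polynomial.eval_one] using h1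
  have hT₀K : ∀ c ∈ S, (T₀.map ιK).eval c ≠ 0 := by
    intro c hc h0
    have h1 := hbezK c
    rw [(hmemS c hc).eq_zero, h0, mul_zero, mul_zero, add_zero] at h1
    exact zero_ne_one h1
  have hroot : ∀ c ∈ S, coeff 0 (PK.eval (C c)) = 0 := fun c hc => by
    rw [coeff_zero_eval_C, hPKcc]; exact (hmemS c hc).eq_zero
  have hQroot : ∀ c ∈ S, coeff 0 (QK.eval (C c)) ≠ 0 := fun c hc => by
    rw [coeff_zero_eval_C, hQKcc]
    have h1 := hT₀K c hc
    rw [hT₀split, Polynomial.eval_mul] at h1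
    exact left_ne_zero_of_mul h1
  have hP'root : ∀ c ∈ S, coeff 0 ((Polynomial.derivative PK).eval (C c)) ≠ 0 := fun c hc => by
    rw [coeff_zero_eval_C, hPK'cc]
    have h1 := hT₀K c hc
    rw [hT₀split, Polynomial.eval_mul] at h1
    exact right_ne_zero_of_mul h1
  have hvanK := coeff_sub_prod_newtonRoot_vanish PK QK hPKm S (hScard.trans hPKdeg.symm) hroot
    hQroot hP'root N
  -- s4: enumerate the roots; the Newton iteration commutes with `θ ↦ c`
  set e : S ≃ Fin P₀.natDegree := Finset.equivFinOfCardEq (hScard.trans hδ.symm) with he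
  set c : Fin P₀.natDegree → AlgebraicClosure F :=
    fun i => ((e.symm i : S) : AlgebraicClosure F) with hcdef
  have hcinj : Function.Injective c := fun i j h => e.symm.injective (Subtype.ext h)
  have hcmem : ∀ i, c i ∈ S := fun i => (e.symm i).2
  have hcroot : ∀ i, P₀.eval₂ ιK (c i) = 0 := fun i => by
    have h1 := hmemS _ (hcmem i)
    rwa [Polynomial.IsRoot, Polynomial.eval_map] at h1
  have hmapmap : ∀ i, (Polynomial.mapRingHom (MvPolynomial.map
      (AdjoinRoot.lift ιK (c i) (hcroot i)))).comp
        (Polynomial.mapRingHom (MvPolynomial.map ιA)) =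
      Polynomial.mapRingHom (MvPolynomial.map ιK :
        MvPolynomial β F →+* MvPolynomial β (AlgebraicClosure F)) := by
    intro i
    have hκA : (AdjoinRoot.lift ιK (c i) (hcroot i)).comp ιA = ιK := by
      rw [hιA, AdjoinRoot.algebraMap_eq]; exact AdjoinRoot.lift_comp_of _
    rw [Polynomial.mapRingHom_comp]
    congr 1
    exact RingHom.ext fun q => by rw [RingHom.comp_apply, MvPolynomial.map_map, hκA]
  have hz : ∀ i, MvPolynomial.map (AdjoinRoot.lift ιK (c i) (hcroot i)) ZA =
      newtonRoot (PK * QK) (c i) N := by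
    intro i
    have hφ : ((P * Q).map (MvPolynomial.map ιA)).map
        (MvPolynomial.map (AdjoinRoot.lift ιK (c i) (hcroot i))) = PK * QK := by
      have h1 := RingHom.congr_fun (hmapmap i) (P * Q)
      simp only [RingHom.comp_apply, Polynomial.coe_mapRingHom] at h1
      rw [h1, Polynomial.map_mul]
    rw [hZA, hEGA]
    have hκθ : AdjoinRoot.lift ιK (c i) (hcroot i) θ = c i := by
      rw [hθ]; exact AdjoinRoot.lift_root _
    refine (map_newton_iterate (AdjoinRoot.lift ιK (c i) (hcroot i)) _ ξinv θ ?_ N).trans ?_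
    · have hκξ : AdjoinRoot.lift ιK (c i) (hcroot i) ξinv = (v.map ιK).eval (c i) := by
        rw [hξinv, AdjoinRoot.lift_mk, Polynomial.eval_map]
      have hder : coeff 0 ((Polynomial.derivative (PK * QK)).eval (C (c i))) =
          (T₀.map ιK).eval (c i) := by
        rw [coeff_zero_eval_C, ← Polynomial.derivative_map, Polynomial.map_mul, hPKcc, hQKcc,
          Polynomial.derivative_mul, Polynomial.eval_add, Polynomial.eval_mul, Polynomial.eval_mul,
          (hmemS _ (hcmem i)).eq_zero, zero_mul, add_zero, hT₀split, Polynomial.eval_mul,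
          Polynomial.derivative_map]
        exact mul_comm _ _
      rw [hφ, hκθ, hκξ, hder]
      have h1 := hbezK (c i)
      rw [(hmemS _ (hcmem i)).eq_zero, mul_zero, zero_add] at h1
      exact h1
    · rw [hφ, hκθ]
  -- s5: the characteristic polynomial is the product over the roots
  have hchar := charpoly_map_eq_prod_of_roots ιK hP₀m ZA c hcinj hcroot
  have hprod : Mch.map (MvPolynomial.map ιK) =
      ∏ x ∈ S, (Polynomial.X - Polynomial.C (newtonRoot (PK * QK) x N)) := by
    rw [hMch, hMm, hchar]
    simp_rw [hz]
    rw [← Finset.prod_coe_sort S]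
    exact Fintype.prod_equiv e.symm _ _ fun i => rfl
  -- s6: descend the congruence to `F`
  have hvan : ∀ i0, ∀ k < N + 1, homogeneousComponent k ((P - Mch).coeff i0) = 0 := by
    intro i0
    refine vanish_of_vanish_map hιKinj ?_
    have h1 : MvPolynomial.map ιK ((P - Mch).coeff i0) =
        (PK - ∏ x ∈ S, (Polynomial.X - Polynomial.C (newtonRoot (PK * QK) x N))).coeff i0 := by
      rw [← hprod, hPK, ← Polynomial.map_sub, Polynomial.coeff_map]
    rw [h1]
    exact hvanK i0
  -- s7: the factor is the truncated characteristic polynomial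
  have heq := eq_sum_homogeneousComponent_of_coeff_vanish Ph a₀ P Mch hPh hvan hN
  -- s8: the cost of `optionEquivLeft.symm Mch`: a determinant of simulated coordinates
  have hZAc : complexity ZA ≤ N * (complexity G + 2) := by
    refine (complexity_newton_iterate_ring_le GA ξinv θ N).trans ?_
    gcongr
    exact ArithCircuit.complexity_map_le ιA G
  have hentry : ∀ j k : Fin P₀.natDegree, complexity (Mm j k) ≤
      (5 * P.natDegree ^ 3 + 6 * P.natDegree ^ 2 + 2 * P.natDegree) *
        (N * (complexity G + 2) + 1) + 3 * P.natDegree := by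
    intro j k
    rw [hMm, Matrix.of_apply]
    refine (CommExtSim.complexity_lmap_le (AdjoinRoot.powerBasis' hP₀m).basis
      ((AdjoinRoot.powerBasis' hP₀m).basis.coord k) _).trans ?_
    have hcard : Fintype.card (Fin (AdjoinRoot.powerBasis' hP₀m).dim) = P.natDegree := by
      rw [Fintype.card_fin, AdjoinRoot.powerBasis'_dim, hδ]
    rw [hcard]
    gcongr
    calc complexity (ZA * C (AdjoinRoot.root P₀ ^ (j : ℕ)))
        ≤ complexity ZA + complexity (C (AdjoinRoot.root P₀ ^ (j : ℕ)) :
            MvPolynomial β (AdjoinRoot P₀)) + 1 := complexity_mul_le_holds _ _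
      _ ≤ N * (complexity G + 2) + 0 + 1 := by
          gcongr
          exact (complexity_C_holds _).le
      _ = N * (complexity G + 2) + 1 := by ring
  set Nmat : Matrix (Fin P₀.natDegree) (Fin P₀.natDegree) (MvPolynomial (Option β) F) :=
    (optionEquivLeft F β).symm.mapMatrix (Matrix.charmatrix Mm) with hNmat
  have hdet : (optionEquivLeft F β).symm Mch = Nmat.det := by
    rw [hMch, Matrix.charpoly, hNmat]
    exact AlgEquiv.map_det _ _
  have hdetpoly : Nmat.det = aeval (fun jk : Fin P₀.natDegree × Fin P₀.natDegree =>
      Nmat jk.1 jk.2) (detPoly (Fin P₀.natDegree) F) := by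
    rw [detPoly, AlgHom.map_det, Matrix.mvPolynomialX_mapMatrix_aeval]
  have hsymm : complexity ((optionEquivLeft F β).symm Mch) ≤
      8 * (P.natDegree + 1) ^ 7 + P.natDegree ^ 2 *
        ((5 * P.natDegree ^ 3 + 6 * P.natDegree ^ 2 + 2 * P.natDegree) *
          (N * (complexity G + 2) + 1) + 3 * P.natDegree + 2) := by
    rw [hdet, hdetpoly]
    refine (complexity_aeval_le _ _).trans ?_
    have h1 : complexity (detPoly (Fin P₀.natDegree) F) ≤ 8 * (P.natDegree + 1) ^ 7 := by
      rw [← hδ]; exact complexity_detPoly_le F _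
    have h2 : ∑ jk : Fin P₀.natDegree × Fin P₀.natDegree, complexity (Nmat jk.1 jk.2) ≤
        P.natDegree ^ 2 * ((5 * P.natDegree ^ 3 + 6 * P.natDegree ^ 2 + 2 * P.natDegree) *
          (N * (complexity G + 2) + 1) + 3 * P.natDegree + 2) := by
      calc ∑ jk : Fin P₀.natDegree × Fin P₀.natDegree, complexity (Nmat jk.1 jk.2)
          ≤ ∑ _jk : Fin P₀.natDegree × Fin P₀.natDegree,
              ((5 * P.natDegree ^ 3 + 6 * P.natDegree ^ 2 + 2 * P.natDegree) *
                (N * (complexity G + 2) + 1) + 3 * P.natDegree + 2) := by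
            refine Finset.sum_le_sum fun jk _ => ?_
            rw [hNmat, AlgEquiv.mapMatrix_apply, Matrix.map_apply]
            exact complexity_symm_charmatrix_le Mm jk.1 jk.2 (hentry jk.1 jk.2)
        _ = P.natDegree ^ 2 * ((5 * P.natDegree ^ 3 + 6 * P.natDegree ^ 2 + 2 * P.natDegree) *
              (N * (complexity G + 2) + 1) + 3 * P.natDegree + 2) := by
            rw [sum_const, card_univ, Fintype.card_prod, Fintype.card_fin, hδ, smul_eq_mul, sq]
    exact add_le_add h1 h2
  -- s9: assembly
  rw [heq]
  refine (complexity_sum_homogeneousComponent_le _ N).trans ?_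
  refine Nat.add_le_add_right (Nat.mul_le_mul_left _ ?_) _
  calc complexity (C a₀ * (optionEquivLeft F β).symm Mch)
      ≤ complexity (C a₀ : MvPolynomial (Option β) F) +
          complexity ((optionEquivLeft F β).symm Mch) + 1 := complexity_mul_le_holds _ _
    _ ≤ 0 + (8 * (P.natDegree + 1) ^ 7 + P.natDegree ^ 2 *
        ((5 * P.natDegree ^ 3 + 6 * P.natDegree ^ 2 + 2 * P.natDegree) *
          (N * (complexity G + 2) + 1) + 3 * P.natDegree + 2)) + 1 := by
        gcongr
        · exact (complexity_C_holds _).le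
    _ = _ := by ring

end Engine

end KaltofenFactor

end Literature.Computability.AlgebraicComplexity

end
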